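import Mathlib.RingTheory.MvPolynomial.EulerIdentity
import Mathlib.Algebra.MvPolynomial.PDeriv
import Mathlib.FieldTheory.Perfect
import Literature.Computability.AlgebraicComplexity.HessianRank
import HarnessLib

/-!
# [OURS · L1 W4.6, rung (iv) «large characteristic»] The tame directrix: for a form of degree `b` with `1, …, b`
# invertible (characteristic `0` or `p > b`) the directional derivatives along the common zeros of the
# `(b−1)`-st partials kill the form — the derivative calculus of characteristic zero is available
# (cell res-hironaka, LADDER-RESOLUTION rung L, D-0089; slot W4.6, seat res-L1-s46-pv-7; host route MarkedTransfer,
# `--supports stmt-ResolutionOfSingularities-16155 --as helper`)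

HONEST FRAMING. Nothing here is a statement of H. Hironaka's manuscript (2017-03-23, [Hironaka2017]) and nothing here
asserts that any statement of it holds. Self-contained commutative algebra over Mathlib (`MvPolynomial.pderiv`, Euler's
identity `MvPolynomial.IsHomogeneous.sum_X_mul_pderiv`); no premise of the manuscript, no FACT-LIST premise. AI review
is weaker than expert review. No `sorry`; axioms standard.

## Why (the «char-0-like regime» of RESCUE-SEED §1 row W4.6 (iv), positive side at the tangent cone)

The barrier `Literature.Barriers.ResolutionOfSingularities.DirectrixSmallCharacteristic` records that for `p` SMALL
relative to the degree the directrix of a form is not governed by derivatives (Hironaka's quadric in characteristic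
`2`: all first partials of `X² + λY² + μZ² + λμW²` vanish, yet the form is not a polynomial in fewer variables over
`k`; CJS Thm. 3.14 needs `char = 0` or `≥ dim/2 + 1`). This file proves the TAME counterpart that regime (iv) rests on:
if `1, 2, …, b` are non-zero in the field `k` (characteristic `0`, or `p > b`), then for a form `F` of degree `b` and
a vector `v` at which every iterated partial `∂_{i_1} ⋯ ∂_{i_{b−1}} F` (a linear form) has vanishing derivative
along `v`, the derivative of `F` along `v` vanishes (`dirDeriv_eq_zero_of_partials`): infinitesimally, `F` «does not
depend on» the directions cut out by its `(b−1)`-st partials — the classical computation of the directrix, which is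
what fails for `p ≤ b`. Ingredients: partial derivatives commute (the tree's `pderiv_pderiv_comm`), iterated partials of a form are
forms (`isHomogeneous_foldr_pderiv`), and a form of degree `d` all of whose `(d−1)`-st iterated partials vanish is
zero when `1, …, d` are invertible (`eq_zero_of_forall_foldr_pderiv_eq_zero`, Euler's identity `d` times).

Iterated partials along a list `l = [i_1, …, i_m]` are written `l.foldr (fun i G => pderiv i G) F`
(= `∂_{i_1} (∂_{i_2} ( ⋯ ∂_{i_m} F))`); the directional derivative along `v : σ → k` is `∑ i, C (v i) * pderiv i F`.
No definition is introduced.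
-/

noncomputable section

set_option linter.dupNamespace false -- mandated namespace of this single-conjunct summit

namespace Summit.ResolutionOfSingularities.ResolutionOfSingularities.Theorems
namespace CampaignW46
namespace TameDirectrix

open MvPolynomial Finsupp

open scoped BigOperators

variable {k : Type*} [Field k] {σ : Type*}

/-! ## Iterated partials (partials commute: the tree's `Literature.Computability.AlgebraicComplexity.pderiv_pderiv_comm`) -/

/-- An iterated partial of a form of degree `n` along a list of length `m` is a form of degree `n − m`. [folklore] -/
theorem isHomogeneous_foldr_pderiv {F : MvPolynomial σ k} {n : ℕ} (hF : F.IsHomogeneous n) (l : List σ) :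
    (l.foldr (fun i G => pderiv i G) F).IsHomogeneous (n - l.length) := by
  induction l with
  | nil => simpa using hF
  | cons i l ih =>
    have := ih.pderiv (i := i)
    simpa [List.foldr_cons, List.length_cons, Nat.sub_sub] using this

/-- Iterating further: `(l ++ l').foldr ∂ F = l.foldr ∂ (l'.foldr ∂ F)`. [folklore] -/
theorem foldr_pderiv_append (l l' : List σ) (F : MvPolynomial σ k) :
    (l ++ l').foldr (fun i G => pderiv i G) F = l.foldr (fun i G => pderiv i G) (l'.foldr (fun i G => pderiv i G) F) :=
  List.foldr_append

/-- A partial derivative passes inside an iterated partial (commutation). [folklore] -/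
theorem pderiv_foldr_pderiv (j : σ) (l : List σ) (F : MvPolynomial σ k) :
    pderiv j (l.foldr (fun i G => pderiv i G) F) = l.foldr (fun i G => pderiv i G) (pderiv j F) := by
  induction l with
  | nil => rfl
  | cons i l ih => simp only [List.foldr_cons, Literature.Computability.AlgebraicComplexity.pderiv_pderiv_comm j i, ih]

/-- The failure for `p ≤ b` recorded as a one-line witness (cf. the barrier `DirectrixSmallCharacteristic` for the
geometric phenomenon): in characteristic `p`, the form `X^p` in one variable has ALL iterated partials of positive order
equal to zero, so the hypothesis of `dirDeriv_eq_zero_of_partials` holds at every `v`, and yet `X^p` is not a form in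
fewer variables — derivatives do not see `p`-th powers. Stated as: `∂ (X^p) = 0`. [folklore] -/
theorem pderiv_X_pow_char (p : ℕ) [Fact p.Prime] [CharP k p] (i : σ) :
    pderiv i ((X i : MvPolynomial σ k) ^ p) = 0 := by
  rw [(pderiv i).leibniz_pow, pderiv_X_self, smul_eq_mul, mul_one]
  have : ((p : ℕ) : MvPolynomial σ k) = 0 := by
    rw [← map_natCast (C : k →+* MvPolynomial σ k), CharP.cast_eq_zero, map_zero]
  rw [nsmul_eq_mul, this, zero_mul]

/-! ## The directional derivative `∑ i, C (v i) * ∂_i` -/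

section Dir

variable [Fintype σ]

/-- The directional derivative commutes with partials. [folklore] -/
theorem pderiv_dirDeriv (v : σ → k) (j : σ) (G : MvPolynomial σ k) :
    pderiv j (∑ i, C (v i) * pderiv i G) = ∑ i, C (v i) * pderiv i (pderiv j G) := by
  rw [map_sum]
  refine Finset.sum_congr rfl fun i _ => ?_
  rw [Derivation.leibniz, pderiv_C, smul_zero, add_zero, smul_eq_mul,
    Literature.Computability.AlgebraicComplexity.pderiv_pderiv_comm]

/-- The directional derivative commutes with iterated partials. [folklore] -/
theorem foldr_pderiv_dirDeriv (v : σ → k) (l : List σ) (G : MvPolynomial σ k) :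
    l.foldr (fun i H => pderiv i H) (∑ i, C (v i) * pderiv i G) =
      ∑ i, C (v i) * pderiv i (l.foldr (fun i H => pderiv i H) G) := by
  induction l with
  | nil => rfl
  | cons j l ih =>
    simp only [List.foldr_cons, ih, pderiv_dirDeriv]

/-- The directional derivative of a form of degree `n` is a form of degree `n − 1`. [folklore] -/
theorem isHomogeneous_dirDeriv {G : MvPolynomial σ k} {n : ℕ} (hG : G.IsHomogeneous n) (v : σ → k) :
    (∑ i, C (v i) * pderiv i G).IsHomogeneous (n - 1) := by
  refine IsHomogeneous.sum _ _ _ fun i _ => ?_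
  simpa using (isHomogeneous_C σ (v i)).mul (hG.pderiv (i := i))

end Dir

/-! ## A form all of whose top iterated partials vanish is zero (tame degrees) -/

section Vanish

variable [Fintype σ]

/-- **Tame forms are detected by their top partials.** If `H` is a form of degree `d`, the natural numbers `1, …, d`
are non-zero in `k`, and every iterated partial of `H` along a list of length `d − 1` vanishes, then `H = 0` (Euler's
identity, `d` times). For `p ≤ d` this fails (`X^p` in characteristic `p`). [folklore] -/
theorem eq_zero_of_forall_foldr_pderiv_eq_zero :
    ∀ (d : ℕ) (H : MvPolynomial σ k), H.IsHomogeneous d → (∀ m : ℕ, 0 < m → m ≤ d → (m : k) ≠ 0) →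
      (∀ l : List σ, l.length = d - 1 → l.foldr (fun i G => pderiv i G) H = 0) → H = 0 := by
  intro d
  induction d with
  | zero => intro H _ _ hl; simpa using hl [] rfl
  | succ d ih =>
    intro H hH hchar hl
    cases d with
    | zero => simpa using hl [] rfl
    | succ d =>
      -- every first partial is a form of degree `d + 1` with vanishing top partials, hence zero
      have hpd : ∀ i, pderiv i H = 0 := by
        intro i
        refine ih (pderiv i H) (by simpa using hH.pderiv (i := i))
          (fun m hm hmd => hchar m hm (Nat.le_succ_of_le hmd)) fun l hlen => ?_
        have := hl (l ++ [i]) (by simp [hlen])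
        simpa [List.foldr_append] using this
      -- Euler: `(d + 2) • H = ∑ X_i ∂_i H = 0`
      have heuler := hH.sum_X_mul_pderiv
      simp only [hpd, mul_zero, Finset.sum_const_zero] at heuler
      have hsmul : ((d + 1 + 1 : ℕ) : k) • H = 0 := by
        rw [Nat.cast_smul_eq_nsmul]; exact heuler.symm
      rcases smul_eq_zero.mp hsmul with h | h
      · exact absurd h (hchar (d + 1 + 1) (Nat.succ_pos _) le_rfl)
      · exact h

end Vanish

/-! ## The tame directrix theorem -/

section Main

variable [Fintype σ]

/-- [OURS · L1 W4.6 (iv); NOT a statement of the manuscript] **The tame directrix (derivative form).** Let `F` be a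
form of degree `b` over a field in which every `m` with `0 < m < b` is non-zero (characteristic `0`, or
characteristic `p ≥ b`). If `v : σ → k` is a common zero of the
derivatives along `v` of all iterated partials `∂_{i_1} ⋯ ∂_{i_{b−1}} F` (linear forms) — i.e. every such linear form
vanishes at `v` — then the derivative of `F` along `v` vanishes: `∑ i, v_i ∂_i F = 0`. This is the computation of the
directrix of a tangent form by its `(b−1)`-st partials, valid exactly in the tame degrees; for `p` small relative to
the degree it fails (barrier `DirectrixSmallCharacteristic`: Hironaka's quadric in characteristic `2`). [folklore] -/
theorem dirDeriv_eq_zero_of_partials {F : MvPolynomial σ k} {b : ℕ} (hF : F.IsHomogeneous b)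
    (hchar : ∀ m : ℕ, 0 < m → m < b → (m : k) ≠ 0) (v : σ → k)
    (hv : ∀ l : List σ, l.length = b - 1 →
      ∑ i, C (v i) * pderiv i (l.foldr (fun i G => pderiv i G) F) = 0) :
    ∑ i, C (v i) * pderiv i F = 0 := by
  -- `H := ∂_v F` is a form of degree `b − 1` whose iterated partials of length `b − 2` all vanish
  refine eq_zero_of_forall_foldr_pderiv_eq_zero (b - 1) _ (isHomogeneous_dirDeriv hF v)
    (fun m hm hmb => hchar m hm (by omega)) fun l hlen => ?_
  rw [foldr_pderiv_dirDeriv]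
  -- the linear form `Λ := ∂_v (∂^l F)` has all first partials zero, hence vanishes (Euler in degree 1), unless `b = 1`
  rcases Nat.lt_or_ge 1 b with hb | hb
  · have hΛ : (∑ i, C (v i) * pderiv i (l.foldr (fun i G => pderiv i G) F)).IsHomogeneous 1 := by
      have := isHomogeneous_dirDeriv (isHomogeneous_foldr_pderiv hF l) v
      rwa [hlen, show b - (b - 1 - 1) - 1 = 1 by omega] at this
    have hpart : ∀ j, pderiv j (∑ i, C (v i) * pderiv i (l.foldr (fun i G => pderiv i G) F)) = 0 := by
      intro j
      rw [pderiv_dirDeriv]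
      have := hv (j :: l) (by simp [hlen]; omega)
      simpa [List.foldr_cons, Literature.Computability.AlgebraicComplexity.pderiv_pderiv_comm j] using this
    have heuler := hΛ.sum_X_mul_pderiv
    simp only [hpart, mul_zero, Finset.sum_const_zero, one_smul] at heuler
    exact heuler.symm
  · -- `b ≤ 1`: the hypothesis at the empty list (length `b − 1 = 0`) is the claim for `∂^l F` with `l = []`
    have hl0 : l = [] := List.length_eq_zero_iff.mp (by omega)
    subst hl0
    exact hv [] (by simp; omega)

/-- [OURS · L1 W4.6 (iv); NOT a statement of the manuscript] The same over a field of characteristic `p > b` (or with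
`b < p` read for the exponent characteristic): the hypothesis «`1, …, b − 1` non-zero in `k`» holds. [folklore] -/
theorem dirDeriv_eq_zero_of_partials_charP (p : ℕ) [CharP k p] {F : MvPolynomial σ k} {b : ℕ} (hpb : b ≤ p ∨ p = 0)
    (hF : F.IsHomogeneous b) (v : σ → k)
    (hv : ∀ l : List σ, l.length = b - 1 →
      ∑ i, C (v i) * pderiv i (l.foldr (fun i G => pderiv i G) F) = 0) :
    ∑ i, C (v i) * pderiv i F = 0 := by
  refine dirDeriv_eq_zero_of_partials hF (fun m hm hmb => ?_) v hv
  rw [Ne, CharP.cast_eq_zero_iff k p m]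
  rcases hpb with hbp | hp0
  · exact fun hdvd => absurd (Nat.le_of_dvd hm hdvd) (by omega)
  · subst hp0
    rw [zero_dvd_iff]
    omega

end Main

end TameDirectrix
end CampaignW46
end Summit.ResolutionOfSingularities.ResolutionOfSingularities.Theorems

end
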